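import Literature.RingTheory.MvPolynomial.CubicFormLinearSubspaces
import HarnessLib

/-!
# Linear subspaces on which a system of forms vanishes (the greedy bound, any degrees)

The greedy construction of `Literature/RingTheory/MvPolynomial/CubicFormLinearSubspaces.lean`
(there for one cubic form) for a finite SYSTEM of forms `F_a ∈ k[x₀, …, x_N]` of positive degrees
`d_a` over an algebraically closed field `k`:

* `exists_finCons_forall_eval_eq_zero` — **the greedy step**: if all `F_a` vanish identically on
  the span of `u` independent vectors `w_j` and
  `Σ_a #{s-monomials of degree < d_a in u variables} + u < N + 1`, there is `y ∉ span(w)` with all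
  `F_a` vanishing on `span(y, w)` (expand `F_a(Σ_j s_j w_j + y)`, bihomogeneous of degree `d_a`,
  `Literature.RingTheory.MvPolynomial.isBihom_aeval`; the coefficients of `s`-degree `< d_a` are
  forms of positive degree in `y`; add `u` escape linear forms; apply the projective dimension
  theorem `Literature.RingTheory.KrullDimension.exists_ne_zero_common_zero_of_isHomogeneous`);
* `exists_linearIndependent_forall_eval_eq_zero` — iterating: `r` independent vectors spanning a
  subspace on which all `F_a` vanish, as soon as the count holds for every `u < r`;
* `exists_linearIndependent_two_forall_eval_eq_zero` — **every intersection of hypersurfaces of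
  degrees `d_a ≥ 1` in `ℙᴺ` with `Σ_a d_a < N` contains a line** (the counts for `u = 0, 1` are
  `#ι` and `Σ_a d_a`); e.g. every `(2,3)` complete intersection in `ℙᴺ`, `N ≥ 6` — in particular
  in `ℙ⁸`, the setting of Tian–Zong's theorem as used by the Hodge routes — contains a line, and
  every hypersurface of degree `d < N` contains a line
  (`exists_linearIndependent_two_eval_eq_zero_of_degree_lt`);
* the subspace forms (`exists_submodule_forall_eval_eq_zero`, `…_finrank_two_…`).

These are the elementary greedy bounds; the sharp non-emptiness ranges for Fano schemes of
complete intersections are Debarre–Manivel, Math. Ann. 312 (1998), Thm. 2.1. [folklore]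
-/

noncomputable section

open _root_.MvPolynomial

namespace Literature.RingTheory.MvPolynomial

universe u

variable {k : Type u} [Field k]

section Step

variable {N u : ℕ}

/-- **Verification step, any degree.** If `P ∈ (k[y])[s]` is bihomogeneous of degree `d` and `v`
is a common zero of its coefficients `coeff_α P` with `|α| < d`, then `P(s := c)(y := t v)` does
not depend on `t`. [folklore] -/
theorem eval_eval_smul_eq_of_isBihom_of_degree {d : ℕ}
    {P : MvPolynomial (Fin u) (MvPolynomial (Fin (N + 1)) k)}
    (hP : ∀ α, (coeff α P).IsHomogeneous (d - α.degree) ∧ (d < α.degree → coeff α P = 0))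
    {v : Fin (N + 1) → k} (hv : ∀ α ∈ P.support, α.degree < d → eval v (coeff α P) = 0)
    (c : Fin u → k) (t : k) :
    eval (t • v) (eval (fun j => C (c j)) P) =
      eval (0 : Fin (N + 1) → k) (eval (fun j => C (c j)) P) := by
  rw [eval_eval_eq_sum, eval_eval_eq_sum]
  refine Finset.sum_congr rfl fun α hα => ?_
  congr 1
  rw [eval_smul_of_isHomogeneous (hP α).1,
    show (0 : Fin (N + 1) → k) = (0 : k) • v from (zero_smul k v).symm,
    eval_smul_of_isHomogeneous (hP α).1]
  by_cases hdeg : α.degree < d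
  · rw [hv α hα hdeg, mul_zero, mul_zero]
  · have h0 : d - α.degree = 0 := by omega
    rw [h0, pow_zero, pow_zero]

/-- Counting the conditions, any degree `d ≥ 1`: the `s`-exponents of degree `< d` in `u`
variables inject into the maps `Fin u → Fin d` with sum `≤ d - 1`. [folklore] -/
theorem card_le_of_degree_lt {d : ℕ} (hd : 0 < d) (S : Finset (Fin u →₀ ℕ))
    (hS : ∀ α ∈ S, α.degree < d) :
    S.card ≤ (Finset.univ.filter (fun f : Fin u → Fin d => ∑ j, (f j : ℕ) ≤ d - 1)).card := by
  classical
  have hle : ∀ α ∈ S, ∀ j, α j ≤ d - 1 := fun α hα j =>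
    Nat.le_sub_one_of_lt (lt_of_le_of_lt (Finsupp.le_degree j α) (hS α hα))
  refine Finset.card_le_card_of_injOn (fun α j => (⟨min (α j) (d - 1), by omega⟩ : Fin d))
    (fun α hα => ?_) (fun α hα β hβ h => ?_)
  · rw [Finset.coe_filter]
    refine ⟨Finset.mem_univ _, ?_⟩
    have h1 : ∑ j, (min (α j) (d - 1) : ℕ) = ∑ j, α j :=
      Finset.sum_congr rfl fun j _ => min_eq_left (hle α hα j)
    rw [h1, ← Finsupp.degree_eq_sum]
    exact Nat.le_sub_one_of_lt (hS α hα)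
  · ext j
    have hj := congr_fun h j
    simp only [Fin.mk.injEq] at hj
    rwa [min_eq_left (hle α hα j), min_eq_left (hle β hβ j)] at hj

/-- **The greedy step for a system of forms.** Let `F_a` (`a ∈ ι`, finite) be forms of positive
degrees `d_a` on `kᴺ⁺¹`, `k` algebraically closed, all vanishing identically on the span of `u`
linearly independent vectors `w_j`. If `Σ_a #{s-monomials of degree < d_a in u variables} + u <
N + 1`, there is a vector `y` independent of the `w_j` such that all `F_a` vanish identically on
`span(y, w₀, …, w_{u-1})`. [folklore] -/
theorem exists_finCons_forall_eval_eq_zero [IsAlgClosed k] {ι : Type*} [Fintype ι]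
    {F : ι → MvPolynomial (Fin (N + 1)) k} {d : ι → ℕ} (hF : ∀ a, (F a).IsHomogeneous (d a))
    (hd : ∀ a, 0 < d a) {w : Fin u → Fin (N + 1) → k} (hw : LinearIndependent k w)
    (hvan : ∀ a (c : Fin u → k), eval (fun m => ∑ j, c j * w j m) (F a) = 0)
    (hN : (∑ a, (Finset.univ.filter
      (fun f : Fin u → Fin (d a) => ∑ j, (f j : ℕ) ≤ d a - 1)).card) + u < N + 1) :
    ∃ y : Fin (N + 1) → k, LinearIndependent k (Fin.cons y w : Fin (u + 1) → Fin (N + 1) → k) ∧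
      ∀ a (c : Fin (u + 1) → k),
        eval (fun m => ∑ j, c j * (Fin.cons y w : Fin (u + 1) → Fin (N + 1) → k) j m) (F a) = 0 := by
  classical
  -- the substituted forms `P a = F_a(Σ_j s_j w_j + y)` and their bihomogeneity
  set P : ι → MvPolynomial (Fin u) (MvPolynomial (Fin (N + 1)) k) := fun a =>
    aeval (fun m : Fin (N + 1) =>
      (∑ j : Fin u, C (C (w j m)) * X j) + C (X m) :
        Fin (N + 1) → MvPolynomial (Fin u) (MvPolynomial (Fin (N + 1)) k)) (F a) with hP_def
  have hP : ∀ a α, (coeff α (P a)).IsHomogeneous (d a - α.degree) ∧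
      (d a < α.degree → coeff α (P a) = 0) := by
    intro a
    refine isBihom_aeval (hF a) _ fun m => ?_
    refine isBihom_add (isBihom_sum _ _ fun j _ => ?_)
      (isBihom_C_of_isHomogeneous_one (isHomogeneous_X k m))
    simpa using isBihom_mul (isBihom_C_C (σ := Fin u) (τ := Fin (N + 1)) (w j m))
      (isBihom_X (k := k) (τ := Fin (N + 1)) j)
  -- a retraction `ψ` of `c ↦ Σ_j c_j w_j`
  have hinj : Function.Injective (Fintype.linearCombination k w) :=
    linearIndependent_iff_injective_fintypeLinearCombination.mp hw
  obtain ⟨ψ, hψ⟩ := LinearMap.exists_leftInverse_of_injective _ (LinearMap.ker_eq_bot.mpr hinj)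
  -- the system of conditions
  set S : ι → Finset (Fin u →₀ ℕ) := fun a => (P a).support.filter (fun α => α.degree < d a)
    with hS_def
  have hSd : ∀ a, ∀ α ∈ S a, α.degree < d a := fun a α hα => (Finset.mem_filter.mp hα).2
  let g : (Σ a, ↥(S a)) ⊕ Fin u → MvPolynomial (Fin (N + 1)) k :=
    Sum.elim (fun x => coeff x.2.1 (P x.1))
      (fun j => ∑ m : Fin (N + 1), C (ψ (Pi.single m 1) j) * X m)
  let deg : (Σ a, ↥(S a)) ⊕ Fin u → ℕ := Sum.elim (fun x => d x.1 - x.2.1.degree) (fun _ => 1)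
  have hg : ∀ i, (g i).IsHomogeneous (deg i) := by
    rintro (⟨a, α⟩ | j)
    · exact (hP a α.1).1
    · exact isHomogeneous_escapeForm ψ j
  have hdeg : ∀ i, 0 < deg i := by
    rintro (⟨a, α⟩ | j)
    · have := hSd a α.1 α.2
      change 0 < d a - α.1.degree
      omega
    · exact Nat.one_pos
  have hcard : Fintype.card ((Σ a, ↥(S a)) ⊕ Fin u) < N + 1 := by
    rw [Fintype.card_sum, Fintype.card_sigma, Fintype.card_fin]
    refine lt_of_le_of_lt (Nat.add_le_add_right (Finset.sum_le_sum fun a _ => ?_) u) hN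
    rw [Fintype.card_coe]
    exact card_le_of_degree_lt (hd a) (S a) (hSd a)
  obtain ⟨y, hy0, hy⟩ :=
    Literature.RingTheory.KrullDimension.exists_ne_zero_common_zero_of_isHomogeneous g deg hg hdeg
      hcard
  have hyS : ∀ a, ∀ α ∈ (P a).support, α.degree < d a → eval y (coeff α (P a)) = 0 :=
    fun a α hα hlt => hy (Sum.inl ⟨a, ⟨α, Finset.mem_filter.mpr ⟨hα, hlt⟩⟩⟩)
  have hyψ : ψ y = 0 := by
    ext j
    rw [← eval_escapeForm ψ j y]
    exact hy (Sum.inr j)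
  have hy_span : y ∉ Submodule.span k (Set.range w) := by
    intro hmem
    rw [← Fintype.range_linearCombination] at hmem
    obtain ⟨c, rfl⟩ := hmem
    have hc : ψ (Fintype.linearCombination k w c) = c := by
      have := LinearMap.congr_fun hψ c
      simpa using this
    have hc0 : c = 0 := hc.symm.trans hyψ
    exact hy0 (by rw [hc0, map_zero])
  refine ⟨y, hw.finCons hy_span, fun a c => ?_⟩
  have key := eval_eval_smul_eq_of_isBihom_of_degree (hP a) (hyS a) (fun j => c j.succ) (c 0)
  rw [hP_def] at key
  simp only at key
  rw [eval_eval_aeval_lin, eval_eval_aeval_lin] at key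
  have h0 : eval (fun m => (∑ j, c j.succ * w j m) + (0 : Fin (N + 1) → k) m) (F a) = 0 := by
    simpa using hvan a (fun j => c j.succ)
  rw [h0] at key
  have hfun : (fun m => ∑ j, c j * (Fin.cons y w : Fin (u + 1) → Fin (N + 1) → k) j m) =
      fun m => (∑ j, c j.succ * w j m) + (c 0 • y) m := by
    ext m
    rw [Fin.sum_univ_succ]
    simp only [Fin.cons_zero, Fin.cons_succ, Pi.smul_apply, smul_eq_mul]
    ring
  rw [hfun]
  exact key

/-- The start of the induction, any positive degree: a form of positive degree vanishes at the
origin. [folklore] -/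
theorem eval_eq_zero_of_fin_zero_of_degree {d : ℕ} (hd : 0 < d) {F : MvPolynomial (Fin (N + 1)) k}
    (hF : F.IsHomogeneous d) (c : Fin 0 → k) (w : Fin 0 → Fin (N + 1) → k) :
    eval (fun m => ∑ j, c j * w j m) F = 0 := by
  have h : (fun m : Fin (N + 1) => ∑ j : Fin 0, c j * w j m) = (0 : k) • (0 : Fin (N + 1) → k) := by
    ext m; simp
  rw [h, eval_smul_of_isHomogeneous hF, zero_pow hd.ne', zero_mul]

/-- **Iterating the greedy step.** If the count holds for every `u < r`, there are `r` linearly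
independent vectors on whose span all the `F_a` vanish. [folklore] -/
theorem exists_linearIndependent_forall_eval_eq_zero [IsAlgClosed k] {ι : Type*} [Fintype ι]
    {F : ι → MvPolynomial (Fin (N + 1)) k} {d : ι → ℕ} (hF : ∀ a, (F a).IsHomogeneous (d a))
    (hd : ∀ a, 0 < d a) (r : ℕ)
    (hN : ∀ u < r, (∑ a, (Finset.univ.filter
      (fun f : Fin u → Fin (d a) => ∑ j, (f j : ℕ) ≤ d a - 1)).card) + u < N + 1) :
    ∃ w : Fin r → Fin (N + 1) → k, LinearIndependent k w ∧
      ∀ a (c : Fin r → k), eval (fun m => ∑ j, c j * w j m) (F a) = 0 := by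
  induction r with
  | zero =>
    exact ⟨fun j => Fin.elim0 j, linearIndependent_empty_type,
      fun a c => eval_eq_zero_of_fin_zero_of_degree (hd a) (hF a) c _⟩
  | succ r ih =>
    obtain ⟨w, hw, hv⟩ := ih fun u hu => hN u (Nat.lt_succ_of_lt hu)
    obtain ⟨y, hy, hvy⟩ := exists_finCons_forall_eval_eq_zero hF hd hw hv (hN r r.lt_succ_self)
    exact ⟨_, hy, hvy⟩

end Step

/-! ### Lines on intersections of hypersurfaces -/

section Lines

variable {N : ℕ}

/-- The count for `u = 0`: one (empty) monomial, whatever the degree `d`. [folklore] -/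
theorem card_filter_fin_zero_of_degree (d : ℕ) :
    (Finset.univ.filter (fun f : Fin 0 → Fin d => ∑ j, (f j : ℕ) ≤ d - 1)).card = 1 := by
  rw [Finset.filter_true_of_mem fun f _ => by simp, Finset.card_univ, Fintype.card_fun,
    Fintype.card_fin, Fintype.card_fin, pow_zero]

/-- The count for `u = 1`: the `d` monomials `1, s, …, s^{d-1}`. [folklore] -/
theorem card_filter_fin_one_of_degree (d : ℕ) :
    (Finset.univ.filter (fun f : Fin 1 → Fin d => ∑ j, (f j : ℕ) ≤ d - 1)).card = d := by
  rw [Finset.filter_true_of_mem fun f _ => ?_, Finset.card_univ, Fintype.card_fun,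
    Fintype.card_fin, Fintype.card_fin, pow_one]
  rw [Fin.sum_univ_one]
  exact Nat.le_sub_one_of_lt (f 0).isLt

/-- **Every intersection of hypersurfaces of positive degrees `d_a` in `ℙᴺ` with `Σ_a d_a < N`
(over an algebraically closed field) contains a line**: the forms vanish on a common
`2`-dimensional subspace of `kᴺ⁺¹`. The two greedy steps need `#ι + 0 < N + 1` and
`Σ_a d_a + 1 < N + 1`. E.g. a quadric and a cubic in `ℙᴺ`, `N ≥ 6`. [folklore] -/
theorem exists_linearIndependent_two_forall_eval_eq_zero [IsAlgClosed k] {ι : Type*} [Fintype ι]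
    {F : ι → MvPolynomial (Fin (N + 1)) k} {d : ι → ℕ} (hF : ∀ a, (F a).IsHomogeneous (d a))
    (hd : ∀ a, 0 < d a) (hN : ∑ a, d a < N) :
    ∃ w : Fin 2 → Fin (N + 1) → k, LinearIndependent k w ∧
      ∀ a (c : Fin 2 → k), eval (fun m => ∑ j, c j * w j m) (F a) = 0 := by
  have hι : Fintype.card ι ≤ ∑ a, d a :=
    calc Fintype.card ι = ∑ _a : ι, 1 := by simp
      _ ≤ ∑ a, d a := Finset.sum_le_sum fun a _ => hd a
  refine exists_linearIndependent_forall_eval_eq_zero hF hd 2 fun u hu => ?_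
  interval_cases u
  · rw [Finset.sum_congr rfl fun a _ => card_filter_fin_zero_of_degree (d a)]
    simp only [Finset.sum_const, smul_eq_mul, mul_one, Finset.card_univ]
    omega
  · rw [Finset.sum_congr rfl fun a _ => card_filter_fin_one_of_degree (d a)]
    exact Nat.add_lt_add_right hN 1

/-- **Every hypersurface of degree `0 < d < N` in `ℙᴺ` (over an algebraically closed field)
contains a line**: a form of degree `d` in `N + 1 > d + 1` variables vanishes on a `2`-dimensional
subspace (greedy bound; sharp: `N ≥ (d + 3)/2`, Debarre–Manivel Thm. 2.1). [folklore] -/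
theorem exists_linearIndependent_two_eval_eq_zero_of_degree_lt [IsAlgClosed k] {d : ℕ}
    (hd : 0 < d) (hdN : d < N) {F : MvPolynomial (Fin (N + 1)) k} (hF : F.IsHomogeneous d) :
    ∃ w : Fin 2 → Fin (N + 1) → k, LinearIndependent k w ∧
      ∀ c : Fin 2 → k, eval (fun m => ∑ j, c j * w j m) F = 0 := by
  obtain ⟨w, hw, hv⟩ := exists_linearIndependent_two_forall_eval_eq_zero (ι := Unit)
    (F := fun _ => F) (d := fun _ => d) (fun _ => hF) (fun _ => hd) (by simpa using hdN)
  exact ⟨w, hw, hv ()⟩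

/-- From a vanishing family to a vanishing subspace, for a system. [folklore] -/
theorem exists_submodule_forall_eval_eq_zero {u : ℕ} {ι : Type*}
    {F : ι → MvPolynomial (Fin (N + 1)) k}
    {w : Fin u → Fin (N + 1) → k} (hw : LinearIndependent k w)
    (hv : ∀ a (c : Fin u → k), eval (fun m => ∑ j, c j * w j m) (F a) = 0) :
    ∃ W : Submodule k (Fin (N + 1) → k), Module.finrank k W = u ∧
      ∀ a, ∀ v ∈ W, eval v (F a) = 0 := by
  refine ⟨Submodule.span k (Set.range w), ?_, fun a v hv' => ?_⟩
  · rw [finrank_span_eq_card hw, Fintype.card_fin]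
  · rw [← Fintype.range_linearCombination] at hv'
    obtain ⟨c, rfl⟩ := hv'
    have h : (Fintype.linearCombination k w c : Fin (N + 1) → k) = fun m => ∑ j, c j * w j m := by
      ext m
      simp [Fintype.linearCombination_apply, Finset.sum_apply]
    rw [h]
    exact hv a c

/-- **Subspace form**: hypersurfaces of positive degrees `d_a` with `Σ d_a < N` have equations
vanishing on a common `2`-dimensional subspace of `kᴺ⁺¹`. [folklore] -/
theorem exists_submodule_finrank_two_forall_eval_eq_zero [IsAlgClosed k] {ι : Type*} [Fintype ι]
    {F : ι → MvPolynomial (Fin (N + 1)) k} {d : ι → ℕ} (hF : ∀ a, (F a).IsHomogeneous (d a))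
    (hd : ∀ a, 0 < d a) (hN : ∑ a, d a < N) :
    ∃ W : Submodule k (Fin (N + 1) → k), Module.finrank k W = 2 ∧
      ∀ a, ∀ v ∈ W, eval v (F a) = 0 := by
  obtain ⟨w, hw, hv⟩ := exists_linearIndependent_two_forall_eval_eq_zero hF hd hN
  exact exists_submodule_forall_eval_eq_zero hw hv

end Lines

end Literature.RingTheory.MvPolynomial

end
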